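import Literature.AlgebraicGeometry.HodgeTheory.GAGADifferentialFormsGlobalSections
import Literature.Algebra.Homology.SerreVanishing
import HarnessLib

/-!
# The Hodge numbers of projective space: `h^{p,q}(ℙ_r) = δ_{pq}`

Bott's formula (Okonek–Schneider–Spindler, *Vector bundles on complex projective spaces*, Ch. I
§ 1.1, p. 8) at twist `k = 0` reads: `h^q(ℙ_n, Ω^p_{ℙ_n}) = 1` for `0 ≤ p = q ≤ n` and `= 0` for
`0 ≤ p ≤ n`, `q ≠ p`; the text adds "It is a useful exercise to deduce the Bott formula by induction
using equations (1), (3) [the exterior powers `0 → Ω^p(p) → 𝒪^{⊕ C(n+1,p)} → Ω^{p-1}(p) → 0` of the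
Euler sequence] and `H^q(ℙ_n, 𝒪_{ℙ_n}) = 0`, `q ≥ 1`". This file carries out that induction for
`k = 0`, in the tree's Čech language for `ℙ_r`, `r ≥ 1`, where `Ω^p(k)` is the degree-`k` Čech
complex `Č_k(Z_p)` of the graded kernel module `Z_p ⊆ Λ^p P^{r+1}(-p)`
(`GAGADifferentialFormsProjectiveSpace`: `GAGAForms.Zsub`, the exact sequences (3) being the short
exact sequences `KoszulCech.Datum.ses` of `OrderedCechKoszulKernels`, split on every `U_s`, `s ≠ ∅`):

* `LaurentCech.nonempty_homology_zero_linearEquiv_iInf` — **`H⁰(Č_d(K)) ≃ ⋂_i (K_{x_i})_d`**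
  (no `(-1)`-cochains; `OrderedCech.kerDZeroEquiv`), for any `K ⊆ F_e`;
* `LaurentCech.iInf_locDeg_top_eq_span_of_forall_eq` — for `r ≥ 1`, one generator (`J` a
  one-element type) of degree `e = d`: `⋂_i ((F_e)_{x_i})_d = A · 𝟙` (Hartshorne III 5.1 (a):
  `H⁰(𝒪) = S_0 = A`);
* `GAGAForms.isZero_homology_freeCx_twist_zero` — `H^a(ℙ_r, Λ^q 𝒪^{r+1}(-q)) = 0` for all `a` and
  `1 ≤ q ≤ r` (Hartshorne III Thm. 5.1: no cohomology of `𝒪(-q)` in that range; degree `0` by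
  `GAGADifferentialFormsGlobalSections`, degrees `≥ 1` by `SerreVanishing`);
* `GAGAForms.isIso_δ_twist_zero` — hence **`H^a(ℙ_r, Ω^q) ≅ H^{a+1}(ℙ_r, Ω^{q+1})`** for `q + 1 ≤ r`
  and every `a` (the connecting maps of (3) at twist `0`);
* **`GAGAForms.isZero_homology_cech_Zsub_twist_zero_of_ne`**, **`finrank_homology_cech_Zsub_twist_zero`**
  — for `0 ≤ p ≤ r`: `H^a(Č_0(Z_p)) = 0` for `a ≠ p` and `dim_ℂ H^p(Č_0(Z_p)) = 1`, i.e.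
  **`h^{p,q}(ℙ_r) = δ_{pq}`** on the algebraic side;
* **`GAGAForms.isZero_homology_holCech_twist_zero_of_ne`**, **`finrank_homology_holCech_twist_zero`**
  — the same for the holomorphic Čech cohomology `Ȟ^a(𝔘^h, Ω^{p,h})` of `ℙ_r(ℂ)`, by Serre's GAGA
  comparison isomorphisms (`GAGAForms.isIso_homologyMap_cechComparison`).

Theorems only; no definitions, no named facts. Not treated here: the twists `k ≠ 0` of Bott's
formula and `p > r` (where `Ω^p = 0`). Mathlib used: `ShortComplex.ShortExact.isIso_δ` (the
connecting map between two vanishing terms is an isomorphism, Weibel Thm. 1.3.1),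
`ShortComplex.moduleCatHomologyIso`, `finrank_span_singleton`.

## References
* [OkonekSchneiderSpindler1980] C. Okonek, M. Schneider, H. Spindler, *Vector bundles on complex
  projective spaces* (1980), Ch. I § 1.1, Bott formula and the remark following it (p. 8).
* [Hartshorne1977] R. Hartshorne, *Algebraic Geometry* (1977), III Thm. 5.1 (p. 225).
* [Weibel1994] C. A. Weibel, *An Introduction to Homological Algebra* (1994), Thm. 1.3.1.
* [GortzWedhorn2023] U. Görtz, T. Wedhorn, *Algebraic Geometry II* (2023), Lemma 21.65 (p. 259).
* [SerreGAGA1956] J.-P. Serre, *GAGA*, Ann. Inst. Fourier 6 (1956), n° 12 Théorème 1.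
-/

noncomputable section

open CategoryTheory CategoryTheory.Limits

universe u

namespace Literature.Algebra.Homology

namespace LaurentCech

open OrderedCech

variable {A : Type u} [CommRing A] {r : ℕ} {J : Type} (e : J → ℤ)
  (K : Submodule (P A r) (J → P A r))

/-! ### `H⁰` of the Čech complex is the intersection of the vertex pieces -/

/-- **`H⁰(Č_d(K)) ≃ ⋂_i (K_{x_i})_d`**: there are no `(-1)`-cochains, so `H⁰ = Ker d⁰`, and a
`0`-cocycle is one vector lying in every vertex piece (`OrderedCech.kerDZeroEquiv`; Görtz–Wedhorn
II Lemma 21.65, `Γ(X, 𝓕) ≅ Ȟ⁰(𝔘, 𝓕)`). [cite: GortzWedhorn2023, Lemma 21.65 (p. 259)] -/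
theorem nonempty_homology_zero_linearEquiv_iInf (d : ℤ) :
    Nonempty (((cech e K d).homology 0) ≃ₗ[A]
      (⨅ i : Fin (r + 1), locDeg e K {i} d : Submodule A (J → L A r))) := by
  set C := cech e K d
  set T := C.sc' (-1) 0 1
  have hg : T.g = ModuleCat.ofHom (OrderedCech.d (fun s => locDeg e K s d) (locDeg_mono e K d) 0) :=
    OrderedCech.complex_d _ (locDeg_mono e K d) 0
  have e₁ : C.homology 0 ≅ T.moduleCatLeftHomologyData.H :=
    C.homologyIsoSc' (-1) 0 1 (by simp) (by simp) ≪≫ T.moduleCatHomologyIso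
  -- no `(-1)`-cochains: the boundaries vanish
  have hbot : LinearMap.range T.moduleCatToCycles = ⊥ := by
    haveI := OrderedCech.isEmpty_simplex_of_neg (ι := Fin (r + 1)) (n := -1) (by norm_num)
    rw [LinearMap.range_eq_bot]
    ext x
    have hx : x = 0 :=
      Subsingleton.elim (α := Cochain (fun s => locDeg e K s d) (-1)) x 0
    rw [hx, map_zero, LinearMap.zero_apply]
  have hker : LinearMap.ker T.g.hom =
      LinearMap.ker (OrderedCech.d (fun s => locDeg e K s d) (locDeg_mono e K d) 0) := by
    rw [hg]; rfl
  let e₂ : T.moduleCatLeftHomologyData.H ≃ₗ[A] LinearMap.ker T.g.hom :=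
    Submodule.quotEquivOfEqBot _ hbot
  exact ⟨e₁.toLinearEquiv ≪≫ₗ e₂ ≪≫ₗ LinearEquiv.ofEq _ _ hker ≪≫ₗ
    kerDZeroEquiv (fun s => locDeg e K s d) (locDeg_mono e K d)⟩

/-! ### One generator in its own degree: `H⁰(𝒪) = A` -/

/-- **`⋂_i ((F_e)_{x_i})_d = A · 𝟙` for a single generator of degree `e = d`** (`r ≥ 1`): a vector in
the intersection has only monomials admissible on every chart, of total degree `0`, i.e. only the
constant monomial (Hartshorne III Thm. 5.1 (a): `H⁰(𝐏^r, 𝒪) = S_0 = A`); conversely the constant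
vector `𝟙` lies in every piece. [cite: Hartshorne1977, III Thm. 5.1 (a)] -/
theorem iInf_locDeg_top_eq_span_of_forall_eq (hr : 1 ≤ r) [Finite J] [Unique J] {d : ℤ}
    (hd : ∀ j, e j = d) :
    (⨅ i : Fin (r + 1), locDeg e (⊤ : Submodule (P A r) (J → P A r)) {i} d) =
      A ∙ (fun _ : J => (1 : L A r)) := by
  apply le_antisymm
  · intro v hv
    rw [Submodule.mem_iInf] at hv
    rw [Submodule.mem_span_singleton]
    refine ⟨(v default).coeff 0, funext fun j => ?_⟩
    obtain rfl : j = default := Unique.eq_default j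
    rw [Pi.smul_apply]
    apply AddMonoidAlgebra.ext
    rw [AddMonoidAlgebra.coeff_smul, AddMonoidAlgebra.one_def, AddMonoidAlgebra.coeff_single,
      Finsupp.smul_single, smul_eq_mul, mul_one, eq_comm, Finsupp.eq_single_iff]
    refine ⟨fun m hm => ?_, rfl⟩
    rw [Finset.mem_singleton]
    have hne : (v default).coeff m ≠ 0 := Finsupp.mem_support_iff.mp hm
    have hadm : ∀ i : Fin (r + 1), m ∈ admissible ({i} : Finset (Fin (r + 1))) (d - e default) :=
      fun i => (mem_locDeg_top_iff e).mp (hv i) default m hne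
    have hnonneg : ∀ k, 0 ≤ m k := by
      intro k
      obtain ⟨i, hik⟩ : ∃ i : Fin (r + 1), i ≠ k := by
        by_cases hk : k = 0
        · exact ⟨⟨1, by omega⟩, fun h => by rw [hk] at h; exact absurd (congrArg Fin.val h) (by simp)⟩
        · exact ⟨0, fun h => hk h.symm⟩
      exact ((mem_admissible).mp (hadm i)).2 k (by rwa [Finset.mem_singleton, ← ne_eq, ne_comm])
    have hdeg : edeg r m = d - e default := ((mem_admissible).mp (hadm 0)).1
    rw [hd, sub_self, edeg_apply] at hdeg
    funext k
    exact (Finset.sum_eq_zero_iff_of_nonneg fun k _ => hnonneg k).mp hdeg k (Finset.mem_univ k)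
  · rw [Submodule.span_le, Set.singleton_subset_iff, SetLike.mem_coe, Submodule.mem_iInf]
    intro i
    rw [mem_locDeg_top_iff]
    intro j m hm
    rw [AddMonoidAlgebra.one_def, AddMonoidAlgebra.coeff_single] at hm
    obtain rfl : m = 0 := by
      by_contra h
      exact hm (Finsupp.single_eq_of_ne h)
    rw [mem_admissible, hd, sub_self, map_zero]
    exact ⟨rfl, fun _ _ => le_rfl⟩

/-- The constant vector `𝟙 ≠ 0` in `L^J`. [folklore] -/
private theorem const_one_ne_zero [Nontrivial A] [Inhabited J] :
    (fun _ : J => (1 : L A r)) ≠ 0 := by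
  intro h
  have := congr_fun h default
  rw [Pi.zero_apply] at this
  exact one_ne_zero this

/-- **`H⁰(Č_d(F_e))` is free of rank one for a single generator of degree `e = d` over a field**
(`r ≥ 1`): `dim H⁰(𝐏^r, 𝒪) = 1`. [cite: Hartshorne1977, III Thm. 5.1 (a)] -/
theorem finrank_homology_cech_top_zero_of_forall_eq {A : Type u} [Field A] (hr : 1 ≤ r)
    [Finite J] [Unique J] (e : J → ℤ) {d : ℤ} (hd : ∀ j, e j = d) :
    Module.finrank A ((cech e (⊤ : Submodule (P A r) (J → P A r)) d).homology 0) = 1 := by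
  obtain ⟨φ⟩ := nonempty_homology_zero_linearEquiv_iInf (A := A) (r := r) e ⊤ d
  rw [φ.finrank_eq, iInf_locDeg_top_eq_span_of_forall_eq e hr hd]
  exact finrank_span_singleton const_one_ne_zero

/-- `H^i(Č_d(K)) = 0` in negative degrees (there are no cochains). [folklore] -/
private theorem isZero_homology_cech_of_neg (d i : ℤ) (hi : i < 0) :
    IsZero ((cech e K d).homology i) :=
  (HomologicalComplex.exactAt_iff_isZero_homology _ _).mp
    (HomologicalComplex.ExactAt.of_isZero (isZero_cech_X_of_neg e K d i hi))

/-- **`H^a(Č_d(F_e)) = 0` for `a ≠ 0`, one generator in degree `e = d`** (`H^a(𝐏^r, 𝒪) = 0` for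
`a ≥ 1`, Hartshorne III Thm. 5.1 (b)–(d), via the tree's `isZero_homology_cech_top_of_ge`).
[cite: Hartshorne1977, III Thm. 5.1] -/
theorem isZero_homology_cech_top_of_forall_eq_of_ne_zero [Finite J] {d : ℤ} (hd : ∀ j, e j = d)
    {a : ℤ} (ha : a ≠ 0) :
    IsZero ((cech e (⊤ : Submodule (P A r) (J → P A r)) d).homology a) := by
  rcases lt_or_gt_of_ne ha with h | h
  · exact isZero_homology_cech_of_neg e ⊤ d a h
  · exact isZero_homology_cech_top_of_ge e d a (by omega) fun j => by rw [hd j]; omega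

/-- **No cohomology strictly between the generating degree and `r` below it**: for `r ≥ 1`,
`F_e` free with all `e_j` in `(d, d + r]`, `H^a(Č_d(F_e)) = 0` for EVERY `a`
(`H^a(𝐏^r, 𝒪(-q)) = 0` for all `a` when `1 ≤ q ≤ r`, Hartshorne III Thm. 5.1).
[cite: Hartshorne1977, III Thm. 5.1] -/
theorem isZero_homology_cech_top_of_forall_lt_le (hr : 1 ≤ r) [Finite J] {d : ℤ}
    (hd : ∀ j, d < e j ∧ e j ≤ d + r) (a : ℤ) :
    IsZero ((cech e (⊤ : Submodule (P A r) (J → P A r)) d).homology a) := by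
  rcases lt_trichotomy a 0 with h | rfl | h
  · exact isZero_homology_cech_of_neg e ⊤ d a h
  · exact isZero_homology_cech_zero_of_forall_lt e ⊤ hr fun j => (hd j).1
  · exact isZero_homology_cech_top_of_ge e d a (by omega) fun j => by have := (hd j).2; omega

end LaurentCech

end Literature.Algebra.Homology

namespace Literature.AlgebraicGeometry.HodgeTheory

namespace GAGAForms

open Literature.Algebra.Homology Literature.Algebra.Homology.LaurentCech
  Literature.Algebra.Homology.KoszulCech

variable {r : ℕ}

/-! ### The exterior powers of the Euler sequence at twist `0` -/

/-- **`H^a(ℙ_r, Λ^q 𝒪^{r+1}(-q)) = 0` for every `a` and `1 ≤ q ≤ r`** — the middle terms of the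
exterior powers (3) of the Euler sequence at twist `0` have no cohomology at all (the free Čech
complexes `KoszulCech.Datum.freeCx` of the algebraic datum are the `Č_0(Λ^q P^{r+1}(-q))`).
[cite: OkonekSchneiderSpindler1980, Ch. I § 1.1, Bott formula (p. 8)] [cite: Hartshorne1977, III Thm. 5.1] -/
theorem isZero_homology_freeCx_twist_zero (hr : 1 ≤ r) {q : ℕ} (hq : 1 ≤ q) (hqr : q ≤ r) (a : ℤ) :
    IsZero (((algDatum r 0).freeCx q).homology a) := by
  change IsZero ((LaurentCech.cech (fun _ : Sub (Fin (r + 1)) q => (q : ℤ))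
    (⊤ : Submodule (P ℂ r) _) 0).homology a)
  exact isZero_homology_cech_top_of_forall_lt_le _ hr (fun _ => ⟨by omega, by omega⟩) a

/-- **The connecting maps `H^a(ℙ_r, Ω^q) → H^{a+1}(ℙ_r, Ω^{q+1})` of the sequences (3) at twist `0`
are isomorphisms for `q + 1 ≤ r` and every `a`** (both neighbouring terms
`H^a, H^{a+1}(Λ^{q+1} 𝒪^{r+1}(-q-1))` vanish; Mathlib `ShortComplex.ShortExact.isIso_δ`).
[cite: OkonekSchneiderSpindler1980, Ch. I § 1.1 (3) and p. 8] [cite: Weibel1994, Thm. 1.3.1] -/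
theorem isIso_δ_twist_zero (hr : 1 ≤ r) {q : ℕ} (hqr : q + 1 ≤ r) (a b : ℤ) (hab : a + 1 = b) :
    IsIso (((algDatum r 0).shortExact_ses uL_mul_xL q).δ a b hab) :=
  ((algDatum r 0).shortExact_ses uL_mul_xL q).isIso_δ a b hab
    (isZero_homology_freeCx_twist_zero hr (by omega) hqr a)
    (isZero_homology_freeCx_twist_zero hr (by omega) hqr b)

/-- The induced isomorphisms `H^a(Č_0(Z_q)) ≅ H^{a+1}(Č_0(Z_{q+1}))`, `q + 1 ≤ r`, between the
Čech cohomology objects of `GAGAForms.Zsub`. [cite: OkonekSchneiderSpindler1980, Ch. I § 1.1 (3) and p. 8] -/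
theorem nonempty_iso_homology_succ (hr : 1 ≤ r) {q : ℕ} (hqr : q + 1 ≤ r) (a b : ℤ)
    (hab : a + 1 = b) :
    Nonempty (((LaurentCech.cech (fun _ : Sub (Fin (r + 1)) q => (q : ℤ)) (Zsub r q) 0).homology a)
      ≅ ((LaurentCech.cech (fun _ : Sub (Fin (r + 1)) (q + 1) => ((q + 1 : ℕ) : ℤ))
        (Zsub r (q + 1)) 0).homology b)) := by
  exact ⟨@asIso _ _ _ _ _ (isIso_δ_twist_zero hr hqr a b hab)⟩

/-! ### `h^{p,q}(ℙ_r) = δ_{pq}` -/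

/-- **Hodge numbers of projective space, off the diagonal (algebraic side)**: for `r ≥ 1`,
`0 ≤ p ≤ r` and `a ≠ p`, `H^a(ℙ_r, Ω^p) = H^a(Č_0(Z_p)) = 0` — Bott's formula at `k = 0`, by
induction on `p` along the isomorphisms `isIso_δ_twist_zero`, starting from
`H^a(ℙ_r, 𝒪) = 0` (`a ≠ 0`). [cite: OkonekSchneiderSpindler1980, Ch. I § 1.1, Bott formula (p. 8)] -/
theorem isZero_homology_cech_Zsub_twist_zero_of_ne (hr : 1 ≤ r) {p : ℕ} (hp : p ≤ r) {a : ℤ}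
    (ha : a ≠ p) :
    IsZero ((LaurentCech.cech (fun _ : Sub (Fin (r + 1)) p => (p : ℤ)) (Zsub r p) 0).homology a) := by
  induction p generalizing a with
  | zero =>
    rw [Zsub_zero]
    exact isZero_homology_cech_top_of_forall_eq_of_ne_zero _ (fun _ => rfl) (by exact_mod_cast ha)
  | succ q ih =>
    obtain ⟨φ⟩ := nonempty_iso_homology_succ hr hp (a - 1) a (by ring)
    exact (ih (by omega) (a := a - 1) (by omega)).of_iso φ.symm

/-- **Hodge numbers of projective space, on the diagonal (algebraic side)**: for `r ≥ 1` and
`0 ≤ p ≤ r`, `dim_ℂ H^p(ℙ_r, Ω^p) = dim_ℂ H^p(Č_0(Z_p)) = 1` — Bott's formula at `k = 0`,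
`p = q`, by the same induction from `dim H⁰(ℙ_r, 𝒪) = 1`.
[cite: OkonekSchneiderSpindler1980, Ch. I § 1.1, Bott formula (p. 8)] -/
theorem finrank_homology_cech_Zsub_twist_zero (hr : 1 ≤ r) {p : ℕ} (hp : p ≤ r) :
    Module.finrank ℂ
      ((LaurentCech.cech (fun _ : Sub (Fin (r + 1)) p => (p : ℤ)) (Zsub r p) 0).homology p) = 1 := by
  induction p with
  | zero =>
    letI : Unique (Sub (Fin (r + 1)) 0) :=
      ⟨⟨⟨∅, Finset.card_empty⟩⟩, fun I => Subtype.ext (Finset.card_eq_zero.mp I.2)⟩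
    rw [Zsub_zero]
    exact finrank_homology_cech_top_zero_of_forall_eq hr _ (fun _ => rfl)
  | succ q ih =>
    obtain ⟨φ⟩ := nonempty_iso_homology_succ hr hp (q : ℤ) ((q + 1 : ℕ) : ℤ) (by omega)
    rw [← φ.toLinearEquiv.finrank_eq]
    exact ih (by omega)

/-- **Hodge numbers of `ℙ_r(ℂ)`, off the diagonal, holomorphic Čech form**: for `r ≥ 1`,
`0 ≤ p ≤ r`, `a ≠ p`, `Ȟ^a(𝔘^h, Ω^{p,h}) = 0`, transported from the algebraic side along Serre's
GAGA isomorphism (`isIso_homologyMap_cechComparison`).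
[cite: OkonekSchneiderSpindler1980, Ch. I § 1.1, Bott formula (p. 8)] [cite: SerreGAGA1956, n° 12 Théorème 1] -/
theorem isZero_homology_holCech_twist_zero_of_ne (hr : 1 ≤ r) {p : ℕ} (hp : p ≤ r) {a : ℤ}
    (ha : a ≠ p) : IsZero ((holCech r p 0).homology a) := by
  haveI := isIso_homologyMap_cechComparison (r := r) p 0 a
  exact (isZero_homology_cech_Zsub_twist_zero_of_ne hr hp ha).of_iso
    (asIso (HomologicalComplex.homologyMap (cechComparison r p 0) a)).symm

/-- **Hodge numbers of `ℙ_r(ℂ)`, on the diagonal, holomorphic Čech form**: for `r ≥ 1` and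
`0 ≤ p ≤ r`, `dim_ℂ Ȟ^p(𝔘^h, Ω^{p,h}) = 1`.
[cite: OkonekSchneiderSpindler1980, Ch. I § 1.1, Bott formula (p. 8)] [cite: SerreGAGA1956, n° 12 Théorème 1] -/
theorem finrank_homology_holCech_twist_zero (hr : 1 ≤ r) {p : ℕ} (hp : p ≤ r) :
    Module.finrank ℂ ((holCech r p 0).homology p) = 1 := by
  haveI := isIso_homologyMap_cechComparison (r := r) p 0 p
  rw [← (asIso (HomologicalComplex.homologyMap (cechComparison r p 0) (p : ℤ))).toLinearEquiv.finrank_eq]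
  exact finrank_homology_cech_Zsub_twist_zero hr hp

end GAGAForms

end Literature.AlgebraicGeometry.HodgeTheory

end
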